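import Mathlib

/-!
# Sketch 3 — EOM-GAIN CEILING and MULTIPLIER BOUND for defect rows (hub-lb-idea-11 g3, LINE idea11-L2;
crux `M3PrimeEdgeSplit.LowerEdge_ge_m4o5`, stmt-Ventures-21721; companion of `SketchPHFDefect.lean`)

Setting (abstract; `X` = moment functionals).  `K0` = the tilt-INDEPENDENT part of the relaxation
(PSD Gram blocks, filling, symmetry/Ward rows that do not involve `H`), `E'` = the stationarity (eom /
Krylov) rows regenerated at the tilted Hamiltonian `H'`, `h'` = the tilted energy functional.  The twin
program value is `v' = inf h' (K0 ∩ E')`; the eom-FREE twin value is `v0' = inf h' K0`; the host optimum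
`x⋆` is feasible for the host cone `K0 ∩ E(H)` and in particular `x⋆ ∈ K0`.

* `cutDepth_le_eomGain` : the cut depth of the twin value row at the host optimum,
  `δ₁ = v' − h' x⋆`, is at most `v' − v0'` = the twin's OWN eom gain.  (So every defect row of this
  class — any tilt direction `K`, any step `s` — is capped by the eom/kry share of the twin program.)
* `lift_le_mul_cutDepth` : if the re-solved host with the row added has value `vnew` certified by a
  Lagrange multiplier `μ ≥ 0` of the row (weak duality: `vnew ≤ c x + μ (v' − h' x)` on the host cone),
  then the LIFT obeys `vnew − v ≤ μ · δ₁`; i.e. crit-2's ratio `L/δ₁ ≤ μ⋆`.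
* `lift_le_mul_eomGain` : the two combined.
Elementary order reasoning, no `sorry`; the analysis (strong duality, existence of optima) is not
formalised and not needed for the inequalities as used.
-/

namespace Summit.Ventures.CertifiedManyBodySolver.Cruxes.LowerEdge_ge_m4o5.PseudoHFDefectRows.Ceiling

variable {X : Type*}

/-- EOM-GAIN CEILING.  `v0'` is any lower bound of `h'` on the tilt-independent cone `K0` (e.g. the
eom-free twin value); the host optimum lies in `K0`; hence `δ₁ = v' - h' x⋆ ≤ v' - v0'`. -/
theorem cutDepth_le_eomGain (K0 : Set X) (h' : X → ℝ) (v' v0' : ℝ) {xstar : X}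
    (hx : xstar ∈ K0) (hv0 : ∀ x ∈ K0, v0' ≤ h' x) :
    v' - h' xstar ≤ v' - v0' := by
  have := hv0 xstar hx
  linarith

/-- In particular a twin whose eom gain is below the bar cannot produce a cut above the bar, whatever
the tilt direction: if `v' - v0' < b` then `δ₁ < b`. -/
theorem no_cut_above_bar_of_small_eomGain (K0 : Set X) (h' : X → ℝ) (v' v0' b : ℝ) {xstar : X}
    (hx : xstar ∈ K0) (hv0 : ∀ x ∈ K0, v0' ≤ h' x) (hgain : v' - v0' < b) :
    v' - h' xstar < b :=
  lt_of_le_of_lt (cutDepth_le_eomGain K0 h' v' v0' hx hv0) hgain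

/-- MULTIPLIER BOUND ON THE LIFT.  Host cone `F` (= `K0 ∩ E(H)`), host objective `c`, host optimum
`x⋆ ∈ F` with value `v = c x⋆`.  The re-solved host with the extra row `v' ≤ h' x` has value `vnew`
certified by a multiplier `μ ≥ 0` in the weak-duality form `∀ x ∈ F, vnew ≤ c x + μ (v' - h' x)`
(Lagrangian relaxation of the row only; the cone is untouched).  Then `vnew - v ≤ μ (v' - h' x⋆)`. -/
theorem lift_le_mul_cutDepth (F : Set X) (c h' : X → ℝ) (v v' vnew μ : ℝ) {xstar : X}
    (hx : xstar ∈ F) (hv : v = c xstar)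
    (hdual : ∀ x ∈ F, vnew ≤ c x + μ * (v' - h' x)) :
    vnew - v ≤ μ * (v' - h' xstar) := by
  have := hdual xstar hx
  linarith

/-- No cut, no lift: if the row does not cut the host optimum (`v' ≤ h' x⋆`) then any `μ ≥ 0`
certificate gives `vnew ≤ v` (re-deriving `zeroGain` for this row class). -/
theorem lift_nonpos_of_no_cut (F : Set X) (c h' : X → ℝ) (v v' vnew μ : ℝ) {xstar : X}
    (hx : xstar ∈ F) (hv : v = c xstar) (hμ : 0 ≤ μ) (hnocut : v' ≤ h' xstar)
    (hdual : ∀ x ∈ F, vnew ≤ c x + μ * (v' - h' x)) :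
    vnew ≤ v := by
  have h1 := lift_le_mul_cutDepth F c h' v v' vnew μ hx hv hdual
  have h2 : μ * (v' - h' xstar) ≤ 0 := mul_nonpos_of_nonneg_of_nonpos hμ (by linarith)
  linarith

/-- CEILING ON THE LIFT.  Combining: with `F ⊆ K0` (the host cone refines the tilt-independent cone),
`vnew - v ≤ μ (v' - v0')` — the lift of one defect row is at most its multiplier times the twin's
eom gain. -/
theorem lift_le_mul_eomGain (F K0 : Set X) (c h' : X → ℝ) (v v' v0' vnew μ : ℝ) {xstar : X}
    (hFK : F ⊆ K0) (hx : xstar ∈ F) (hv : v = c xstar) (hμ : 0 ≤ μ)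
    (hv0 : ∀ x ∈ K0, v0' ≤ h' x)
    (hdual : ∀ x ∈ F, vnew ≤ c x + μ * (v' - h' x)) :
    vnew - v ≤ μ * (v' - v0') := by
  have h1 := lift_le_mul_cutDepth F c h' v v' vnew μ hx hv hdual
  have h2 := cutDepth_le_eomGain K0 h' v' v0' (hFK hx) hv0
  have h3 : μ * (v' - h' xstar) ≤ μ * (v' - v0') := mul_le_mul_of_nonneg_left h2 hμ
  linarith

end Summit.Ventures.CertifiedManyBodySolver.Cruxes.LowerEdge_ge_m4o5.PseudoHFDefectRows.Ceiling
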